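import Summits.QuantumFields.YangMills.Theorems.StaticSourceWitnessRungDefs
import Literature.Probability.LatticeModels.LatticeGreenGradient

/-!
# Route `StaticSourceWitness`, crux X₁ `StaticSourceResponse` (stmt-QuantumFields-25284):
# lattice-Maxwell rung, file 4/5 — far-field positivity of the parallel-plaquette kernel,
# the separation geometry, and the probe bump

Banking file (`--supports stmt-QuantumFields-25284`), port of Part C (first half) of the crux workfile
`Cruxes/StaticSourceResponse/Lines/rung.lean` v3 (seat `ym-mirror-bc5w-1`, 2026-08-28).

* `curvatureTwoPoint_P12` — closed form of the `dGd*` kernel between parallel `(1,2)` plaquettes: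
  `curvatureTwoPoint (x;1,2) (y;1,2) = −(Δ₁G + Δ₂G)(x − y)/2` (`G = latticeGreen`), read off the
  definition `curvatureTwoPoint = ∑ σₐσ_b edgeGreen` (Literature `CurvatureGaussianField`); it agrees
  with the tree's `WeakCouplingRates.curl_greenTensor_parallel`, re-derived here in four lines so that
  this file stays outside every route's import cone;
* `secondDiff_asymp` — Lawler (1.37) at `d = 4` in the normalisation used here,
  `|ΔᵢG(z) + π⁻²(|z|⁻⁴ − 4zᵢ²|z|⁻⁶)| ≤ K|z|⁻⁵` (Literature `latticeGreen_second_diff_continuum`);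
* `kernel_cone_lower` — **far-field positivity in the transverse cone**: some `R₀ ≥ 1` such that on
  `4(z₁² + z₂²) ≤ |z|²`, `|z| ≥ R₀` the parallel kernel is `≥ 1/(4π²|z|⁴)`;
* `geom` — the separation vector between a source plaquette and a probe site of the hyperscaling
  configuration lies in that cone with `N² ≤ |z|² ≤ 16650 N²`;
* the probe `wfun ℓ` (bump at `(ℓ/2)e₀`, radii `ℓ/8, ℓ/4`): support in `{y₀ > 0} ∩ B̄(0, ℓ)`,
  nonnegative, `≠ 0`, and `≡ 1` where `|x₀ − ℓ/2|, |x_k| ≤ ℓ/16` (`wfun_eq_one_of_coord`).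

File 5/5 assembles these into the dipole-energy floor.  NOTHING here proves the Yang–Mills mass gap,
`BalabanLadder.NT`, or X₁.
-/

set_option autoImplicit false

open scoped Real

noncomputable section

namespace Summit.QuantumFields.YangMills.Theorems.StaticSourceWitness.Rung

section Floor

open Literature.Probability.LatticeModels Literature.MathematicalPhysics.QuantumLattice
  Literature.MathematicalPhysics.QuantumFieldTheory
open Metric Set

/-! ## the parallel-plaquette kernel -/

/-- `S z = z₀² + z₁² + z₂² + z₃²`. [folklore] -/
theorem S_eq (z : Site 4) :
    S z = ((z 0 : ℤ) : ℝ) ^ 2 + ((z 1 : ℤ) : ℝ) ^ 2 + ((z 2 : ℤ) : ℝ) ^ 2 + ((z 3 : ℤ) : ℝ) ^ 2 := by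
  simp [S, Fin.sum_univ_four]

/-- `0 ≤ S z`. [folklore] -/
theorem S_nonneg (z : Site 4) : 0 ≤ S z := Finset.sum_nonneg fun _ _ => sq_nonneg _

/-- `S (x − y)` written out. [folklore] -/
theorem S_sub (x y : Site 4) : S (x - y) = ∑ j, (((x j : ℤ) : ℝ) - ((y j : ℤ) : ℝ)) ^ 2 := by
  simp [S]

/-- `S z > 0` for `z ≠ 0`. [folklore] -/
theorem S_pos_of_ne {z : Site 4} (hz : z ≠ 0) : 0 < S z := by
  rcases Function.ne_iff.mp hz with ⟨j, hj⟩
  have hj' : ((z j : ℤ) : ℝ) ≠ 0 := by exact_mod_cast hj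
  have : 0 < ((z j : ℤ) : ℝ) ^ 2 := by positivity
  exact lt_of_lt_of_le this (Finset.single_le_sum (f := fun j => ((z j : ℤ) : ℝ) ^ 2)
    (fun _ _ => sq_nonneg _) (Finset.mem_univ j))

/-- `S z > 0` forces `z ≠ 0`. [folklore] -/
theorem ne_zero_of_S_pos {z : Site 4} (h : 0 < S z) : z ≠ 0 := by
  rintro rfl
  simp [S] at h

/-- **Closed form between parallel `(1,2)` plaquettes**:
`curvatureTwoPoint (x;1,2) (y;1,2) = −((Δ₁G)(x−y) + (Δ₂G)(x−y))/2`, `ΔᵢG(z) = G(z+eᵢ) + G(z−eᵢ) − 2G(z)`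
— only boundary edges of equal direction pair under `edgeGreen`. [folklore] -/
theorem curvatureTwoPoint_P12 (x y : Site 4) :
    curvatureTwoPoint (x, P12) (y, P12) =
      -((latticeGreen (x - y + Pi.single 1 1) + latticeGreen (x - y - Pi.single 1 1)
          - 2 * latticeGreen (x - y)) +
        (latticeGreen (x - y + Pi.single 2 1) + latticeGreen (x - y - Pi.single 2 1)
          - 2 * latticeGreen (x - y))) / 2 := by
  have h12 : ((1 : Fin 4) = 2) = False := by decide
  have h21 : ((2 : Fin 4) = 1) = False := by decide
  simp only [curvatureTwoPoint, Fin.sum_univ_four, plaquetteBoundary, plaquetteBoundarySign,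
    edgeGreen_apply, P12, Matrix.cons_val_zero, Matrix.cons_val_one, Matrix.cons_val, h12, h21,
    if_true, if_false]
  have e1 : x + Pi.single 2 1 - y = x - y + Pi.single 2 1 := by abel
  have e2 : x - (y + Pi.single 2 1) = x - y - Pi.single 2 1 := by abel
  have e3 : x + Pi.single 2 1 - (y + Pi.single 2 1) = x - y := by abel
  have e4 : x + Pi.single 1 1 - y = x - y + Pi.single 1 1 := by abel
  have e5 : x - (y + Pi.single 1 1) = x - y - Pi.single 1 1 := by abel
  have e6 : x + Pi.single 1 1 - (y + Pi.single 1 1) = x - y := by abel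
  rw [e1, e2, e3, e4, e5, e6]
  ring

/-- **Lawler (1.37) at `d = 4`** in the normalisation used here:
`|ΔᵢG(z) + (1/π²)(1/S² − 4 zᵢ²/S³)| ≤ K/(S²√S)`, `S = |z|²`, all `z ≠ 0`
(Literature `latticeGreen_second_diff_continuum`; `a₄ = Γ(1)/(2π²) = 1/(2π²)`).
[cite: Lawler1991, Theorem 1.5.5 (1.37)] -/
theorem secondDiff_asymp : ∃ K : ℝ, 0 ≤ K ∧ ∀ z : Site 4, z ≠ 0 → ∀ i : Fin 4,
    |latticeGreen (z + Pi.single i 1) + latticeGreen (z - Pi.single i 1) - 2 * latticeGreen z +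
        (1 / π ^ 2) * (1 / S z ^ 2 - 4 * ((z i : ℤ) : ℝ) ^ 2 / S z ^ 3)|
      ≤ K / (S z ^ 2 * Real.sqrt (S z)) := by
  obtain ⟨K, hK0, hK⟩ := latticeGreen_second_diff_continuum (d := 4) (by norm_num)
  refine ⟨K, hK0, fun z hz i => ?_⟩
  have h := hK z hz i
  have hSpos : 0 < S z := S_pos_of_ne hz
  have hs : Real.sqrt (∑ j, ((z j : ℤ) : ℝ) ^ 2) = Real.sqrt (S z) := rfl
  set r := Real.sqrt (S z) with hr
  have hrpos : 0 < r := Real.sqrt_pos.mpr hSpos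
  have hr2 : r ^ 2 = S z := Real.sq_sqrt hSpos.le
  have ha : Real.Gamma (((4 : ℕ) : ℝ) / 2 - 1) / (2 * π ^ (((4 : ℕ) : ℝ) / 2)) = 1 / (2 * π ^ 2) := by
    have h1 : (((4 : ℕ) : ℝ) / 2 - 1) = 1 := by norm_num
    have h2 : (((4 : ℕ) : ℝ) / 2) = ((2 : ℕ) : ℝ) := by norm_num
    rw [h1, h2, Real.Gamma_one, Real.rpow_natCast]
  have hpow4 : r ^ (-((4 : ℕ) : ℝ)) = 1 / S z ^ 2 := by
    rw [Real.rpow_neg hrpos.le, Real.rpow_natCast, one_div, ← hr2]; ring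
  have hpow6 : r ^ (-(((4 : ℕ) : ℝ) + 2)) = 1 / S z ^ 3 := by
    rw [show (-(((4 : ℕ) : ℝ) + 2)) = -((6 : ℕ) : ℝ) by norm_num, Real.rpow_neg hrpos.le,
      Real.rpow_natCast, one_div, ← hr2]; ring
  have hpow5 : r ^ (-(((4 : ℕ) : ℝ) + 1)) = 1 / (S z ^ 2 * r) := by
    rw [show (-(((4 : ℕ) : ℝ) + 1)) = -((5 : ℕ) : ℝ) by norm_num, Real.rpow_neg hrpos.le,
      Real.rpow_natCast, one_div, ← hr2]; ring
  rw [hs, ha, hpow4, hpow6, hpow5] at h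
  have e4 : (2 - ((4 : ℕ) : ℝ)) = -2 := by norm_num
  rw [e4] at h
  have key : latticeGreen (z + Pi.single i 1) + latticeGreen (z - Pi.single i 1) - 2 * latticeGreen z +
        1 / π ^ 2 * (1 / S z ^ 2 - 4 * ((z i : ℤ) : ℝ) ^ 2 / S z ^ 3) =
      latticeGreen (z + Pi.single i 1) + latticeGreen (z - Pi.single i 1) - 2 * latticeGreen z -
        1 / (2 * π ^ 2) * (-2 * (1 / S z ^ 2 - (4 : ℕ) * ((z i : ℤ) : ℝ) ^ 2 * (1 / S z ^ 3))) := by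
    push_cast; ring
  rw [key]
  have e5 : K * (1 / (S z ^ 2 * r)) = K / (S z ^ 2 * r) := by ring
  rw [e5] at h
  exact h

/-- **Far-field positivity of the parallel-plaquette curvature kernel in the transverse cone.**
There is `R₀ ≥ 1` such that for all sites `x, y` with `z = x − y` in the cone `4(z₁² + z₂²) ≤ |z|²`
and `|z| ≥ R₀`: `curvatureTwoPoint (x;1,2) (y;1,2) ≥ 1/(4π²|z|⁴)`. -/
theorem kernel_cone_lower : ∃ R₀ : ℝ, 1 ≤ R₀ ∧ ∀ x y : Site 4,
    4 * ((((x - y) 1 : ℤ) : ℝ) ^ 2 + (((x - y) 2 : ℤ) : ℝ) ^ 2) ≤ S (x - y) → R₀ ^ 2 ≤ S (x - y) →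
      1 / (4 * π ^ 2 * S (x - y) ^ 2) ≤ curvatureTwoPoint (x, P12) (y, P12) := by
  obtain ⟨K, hK0, hK⟩ := secondDiff_asymp
  refine ⟨4 * π ^ 2 * K + 1, by nlinarith [Real.pi_pos, mul_nonneg (sq_nonneg π) hK0],
    fun x y hcone hfar => ?_⟩
  set z : Site 4 := x - y with hz
  have hR0pos : 0 < 4 * π ^ 2 * K + 1 := by positivity
  have hSpos : 0 < S z := lt_of_lt_of_le (by positivity) hfar
  have hz0 : z ≠ 0 := ne_zero_of_S_pos hSpos
  set s := S z with hs
  set r := Real.sqrt s with hr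
  have hrpos : 0 < r := Real.sqrt_pos.mpr hSpos
  have hrR : 4 * π ^ 2 * K + 1 ≤ r := by
    have : Real.sqrt ((4 * π ^ 2 * K + 1) ^ 2) ≤ Real.sqrt s := Real.sqrt_le_sqrt hfar
    rwa [Real.sqrt_sq hR0pos.le] at this
  have h1 := hK z hz0 1
  have h2 := hK z hz0 2
  rw [curvatureTwoPoint_P12, ← hz]
  set A1 := latticeGreen (z + Pi.single 1 1) + latticeGreen (z - Pi.single 1 1) - 2 * latticeGreen z
    with hA1
  set A2 := latticeGreen (z + Pi.single 2 1) + latticeGreen (z - Pi.single 2 1) - 2 * latticeGreen z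
    with hA2
  set q : ℝ := ((z 1 : ℤ) : ℝ) ^ 2 + ((z 2 : ℤ) : ℝ) ^ 2 with hq
  -- the main term
  have hmain : 1 / (2 * π ^ 2 * s ^ 2) ≤
      (1 / π ^ 2 * (1 / s ^ 2 - 4 * ((z 1 : ℤ) : ℝ) ^ 2 / s ^ 3) +
        1 / π ^ 2 * (1 / s ^ 2 - 4 * ((z 2 : ℤ) : ℝ) ^ 2 / s ^ 3)) / 2 := by
    have hq' : 4 * q ≤ s := hcone
    have e : (1 / π ^ 2 * (1 / s ^ 2 - 4 * ((z 1 : ℤ) : ℝ) ^ 2 / s ^ 3) +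
        1 / π ^ 2 * (1 / s ^ 2 - 4 * ((z 2 : ℤ) : ℝ) ^ 2 / s ^ 3)) / 2
          = 1 / π ^ 2 * (1 / s ^ 2 - 2 * q / s ^ 3) := by
      rw [hq]; ring
    rw [e]
    have hq2 : 2 * q / s ^ 3 ≤ 1 / (2 * s ^ 2) := by
      rw [div_le_div_iff₀ (by positivity) (by positivity)]
      nlinarith [hSpos, sq_nonneg s]
    have hpi : 0 < 1 / π ^ 2 := by positivity
    have e2 : 1 / (2 * π ^ 2 * s ^ 2) = 1 / π ^ 2 * (1 / s ^ 2 - 1 / (2 * s ^ 2)) := by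
      field_simp; ring
    rw [e2]
    exact mul_le_mul_of_nonneg_left (by linarith) hpi.le
  -- the error term
  have herr : K / (s ^ 2 * r) ≤ 1 / (4 * π ^ 2 * s ^ 2) := by
    rw [div_le_div_iff₀ (by positivity) (by positivity)]
    have : 4 * π ^ 2 * K ≤ r := by linarith
    nlinarith [sq_nonneg s, hSpos]
  have e3 : 1 / (2 * π ^ 2 * s ^ 2) - 1 / (4 * π ^ 2 * s ^ 2) = 1 / (4 * π ^ 2 * s ^ 2) := by
    field_simp; ring
  have hb1 := (abs_le.mp h1).2
  have hb2 := (abs_le.mp h2).2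
  linarith

/-! ## pure arithmetic: the separation geometry -/

/-- The separation vector `z = (−X − y₀, m − y₁, n − y₂, −y₃)` between a plaquette of the source
(`0 ≤ m, n ≤ N`) and a probe site (`|y₀ − X|, |y_k| ≤ N`), `32N ≤ X ≤ 64N`: it lies in the transverse
cone, is far (`|z|² ≥ N²`) and not too far (`|z|² ≤ 16650 N²`). -/
theorem geom {X N m n y0 y1 y2 y3 : ℝ} (hN : 1 ≤ N) (hX1 : 32 * N ≤ X) (hX2 : X ≤ 64 * N)
    (hm0 : 0 ≤ m) (hmN : m ≤ N) (hn0 : 0 ≤ n) (hnN : n ≤ N)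
    (hy0 : |y0 - X| ≤ N) (hy1 : |y1| ≤ N) (hy2 : |y2| ≤ N) (hy3 : |y3| ≤ N) :
    4 * ((m - y1) ^ 2 + (n - y2) ^ 2) ≤ (-X - y0) ^ 2 + (m - y1) ^ 2 + (n - y2) ^ 2 + (-y3) ^ 2 ∧
    N ^ 2 ≤ (-X - y0) ^ 2 + (m - y1) ^ 2 + (n - y2) ^ 2 + (-y3) ^ 2 ∧
    (-X - y0) ^ 2 + (m - y1) ^ 2 + (n - y2) ^ 2 + (-y3) ^ 2 ≤ 16650 * N ^ 2 := by
  have sq_le_of_abs_le : ∀ {t B : ℝ}, |t| ≤ B → t ^ 2 ≤ B ^ 2 :=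
    fun h => sq_le_sq' (abs_le.mp h).1 (abs_le.mp h).2
  have h1 : |m - y1| ≤ 2 * N := by
    rw [abs_le] at hy1 ⊢; constructor <;> linarith
  have h2 : |n - y2| ≤ 2 * N := by
    rw [abs_le] at hy2 ⊢; constructor <;> linarith
  have h3 : |(-y3)| ≤ N := by rw [abs_neg]; exact hy3
  have h0u : |(-X - y0)| ≤ 129 * N := by
    rw [abs_le] at hy0 ⊢; constructor <;> linarith
  have h0l : 63 * N ≤ |(-X - y0)| := by
    rw [abs_le] at hy0
    rw [le_abs]; right; linarith
  have s1 := sq_le_of_abs_le h1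
  have s2 := sq_le_of_abs_le h2
  have s3 := sq_le_of_abs_le h3
  have s0u := sq_le_of_abs_le h0u
  have s0l : (63 * N) ^ 2 ≤ (-X - y0) ^ 2 := by
    have := sq_le_sq' (by linarith [abs_nonneg (-X - y0)]) h0l
    rwa [sq_abs] at this
  refine ⟨by nlinarith, by nlinarith, by nlinarith⟩

/-! ## the probe: a bump at `(ℓ/2)e₀` -/

/-- Coordinates of the probe centre. [folklore] -/
theorem ctr_apply (ℓ : ℝ) (k : Fin 4) : ctr ℓ k = if k = 0 then ℓ / 2 else 0 := by
  simp [ctr]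

/-- `‖ctr ℓ‖ = ℓ/2` for `ℓ ≥ 0`. [folklore] -/
theorem norm_ctr {ℓ : ℝ} (hℓ : 0 ≤ ℓ) : ‖ctr ℓ‖ = ℓ / 2 := by
  rw [ctr, PiLp.norm_single, Real.norm_of_nonneg (by linarith)]

/-- Inner radius of the bump. [folklore] -/
@[simp] theorem bump_rIn (ℓ : ℝ) (hℓ : 0 < ℓ) : (bump ℓ hℓ).rIn = ℓ / 8 := rfl

/-- Outer radius of the bump. [folklore] -/
@[simp] theorem bump_rOut (ℓ : ℝ) (hℓ : 0 < ℓ) : (bump ℓ hℓ).rOut = ℓ / 4 := rfl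

/-- The probe is the bump, pointwise. [folklore] -/
@[simp] theorem wfun_apply (ℓ : ℝ) (hℓ : 0 < ℓ) (x : EuclideanSpace ℝ (Fin 4)) :
    wfun ℓ hℓ x = bump ℓ hℓ x := rfl

section Scale
variable {ℓ : ℝ} (hℓ : 0 < ℓ)

/-- Points of `B̄(ctr ℓ, ℓ/4)` have time coordinate `≥ ℓ/4`. [folklore] -/
theorem time_lower_of_mem {x : EuclideanSpace ℝ (Fin 4)} (hx : x ∈ closedBall (ctr ℓ) (ℓ / 4)) :
    ℓ / 4 ≤ x 0 := by
  rw [mem_closedBall, dist_eq_norm] at hx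
  have h1 : |(x - ctr ℓ) 0| ≤ ‖x - ctr ℓ‖ := by
    simpa [Real.norm_eq_abs] using PiLp.norm_apply_le (x - ctr ℓ) 0
  have h2 : (x - ctr ℓ) 0 = x 0 - ℓ / 2 := by simp [ctr_apply]
  rw [h2] at h1
  have := (abs_le.mp (h1.trans hx)).1
  linarith

include hℓ in
/-- Points of `B̄(ctr ℓ, ℓ/4)` have norm `≤ 3ℓ/4`. [folklore] -/
theorem norm_le_of_mem {x : EuclideanSpace ℝ (Fin 4)} (hx : x ∈ closedBall (ctr ℓ) (ℓ / 4)) :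
    ‖x‖ ≤ 3 * ℓ / 4 := by
  rw [mem_closedBall, dist_eq_norm] at hx
  have hc : ‖ctr ℓ‖ = ℓ / 2 := norm_ctr hℓ.le
  calc ‖x‖ = ‖(x - ctr ℓ) + ctr ℓ‖ := by rw [sub_add_cancel]
    _ ≤ ‖x - ctr ℓ‖ + ‖ctr ℓ‖ := norm_add_le _ _
    _ ≤ ℓ / 4 + ℓ / 2 := add_le_add hx hc.le
    _ = 3 * ℓ / 4 := by ring

/-- The probe is supported in positive time `{y₀ > 0}`. -/
theorem wfun_tsupport_pos : tsupport (wfun ℓ hℓ : EuclideanSpace ℝ (Fin 4) → ℝ) ⊆ {y | 0 < y 0} := by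
  intro x hx
  change x ∈ tsupport (bump ℓ hℓ) at hx
  rw [(bump ℓ hℓ).tsupport_eq, bump_rOut] at hx
  have := time_lower_of_mem hx
  show 0 < x 0
  linarith

/-- The probe is supported in the window `B̄(0, ℓ)`. -/
theorem wfun_tsupport_ball :
    tsupport (wfun ℓ hℓ : EuclideanSpace ℝ (Fin 4) → ℝ) ⊆ closedBall 0 ℓ := by
  intro x hx
  change x ∈ tsupport (bump ℓ hℓ) at hx
  rw [(bump ℓ hℓ).tsupport_eq, bump_rOut] at hx
  rw [mem_closedBall, dist_zero_right]
  have := norm_le_of_mem hℓ hx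
  linarith

/-- The probe is nonnegative. -/
theorem wfun_nonneg (z : EuclideanSpace ℝ (Fin 4)) : 0 ≤ wfun ℓ hℓ z := (bump ℓ hℓ).nonneg' z

/-- The probe is not the zero function (it is `1` at its centre). -/
theorem wfun_ne_zero : (wfun ℓ hℓ : EuclideanSpace ℝ (Fin 4) → ℝ) ≠ 0 := by
  intro h
  have h1 : wfun ℓ hℓ (ctr ℓ) = 1 := by
    rw [wfun_apply]
    exact (bump ℓ hℓ).one_of_mem_closedBall (mem_closedBall_self (by simp; positivity))
  have h2 : wfun ℓ hℓ (ctr ℓ) = 0 := by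
    have := congr_fun h (ctr ℓ); simpa using this
  rw [h1] at h2; exact one_ne_zero h2

/-- The probe equals `1` at every point whose coordinates are within `ℓ/16` of the centre's. -/
theorem wfun_eq_one_of_coord {x : EuclideanSpace ℝ (Fin 4)} (h0 : |x 0 - ℓ / 2| ≤ ℓ / 16)
    (hk : ∀ k : Fin 4, k ≠ 0 → |x k| ≤ ℓ / 16) : wfun ℓ hℓ x = 1 := by
  rw [wfun_apply]
  apply (bump ℓ hℓ).one_of_mem_closedBall
  rw [mem_closedBall, dist_eq_norm, bump_rIn]
  have sq_le_of_abs_le : ∀ {t B : ℝ}, |t| ≤ B → t ^ 2 ≤ B ^ 2 :=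
    fun h => sq_le_sq' (abs_le.mp h).1 (abs_le.mp h).2
  have hsq : ‖x - ctr ℓ‖ ^ 2 ≤ (ℓ / 8) ^ 2 := by
    rw [EuclideanSpace.real_norm_sq_eq, Fin.sum_univ_four]
    have e0 : (x - ctr ℓ) 0 = x 0 - ℓ / 2 := by simp [ctr_apply]
    have e1 : (x - ctr ℓ) 1 = x 1 := by simp [ctr_apply]
    have e2 : (x - ctr ℓ) 2 = x 2 := by simp [ctr_apply]
    have e3 : (x - ctr ℓ) 3 = x 3 := by simp [ctr_apply]
    rw [e0, e1, e2, e3]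
    have s0 := sq_le_of_abs_le h0
    have s1 := sq_le_of_abs_le (hk 1 (by decide))
    have s2 := sq_le_of_abs_le (hk 2 (by decide))
    have s3 := sq_le_of_abs_le (hk 3 (by decide))
    nlinarith
  exact (pow_le_pow_iff_left₀ (norm_nonneg _) (by positivity) two_ne_zero).1 hsq

end Scale

end Floor

end Summit.QuantumFields.YangMills.Theorems.StaticSourceWitness.Rung

end
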